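import Summits.BirchSwinnertonDyer.BirchSwinnertonDyer.Theorems.ByReductionTypeAtTwoFineSelmerConjAAtTwoAdditivePotGoodNarrowRankCertificate63644Units
import Summits.BirchSwinnertonDyer.BirchSwinnertonDyer.Theorems.ByReductionTypeAtTwoFineSelmerConjAAtTwoAdditivePotGoodNarrowRankCertificate63644Dyadic
import Summits.BirchSwinnertonDyer.BirchSwinnertonDyer.Theorems.ByReductionTypeAtTwoFineSelmerConjAAtTwoAdditivePotGoodTwoLayerStampsEvenIndexA
import HarnessLib

/-!
# Route `ByReductionTypeAtTwo` (rung K4), crux C1″ `FineSelmerConjAAtTwoAdditivePotGood` (item stmt-BirchSwinnertonDyer-22615):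
# THE TOTALLY REAL CUBIC FIELD OF DISCRIMINANT `316` (`θ³ − θ² − 4θ + 2 = 0`, the `2`-torsion point field of the census row `261648q1`,
# `2 = 𝔭₁𝔭₂²`) — real embeddings, the dyadic primes `(θ − 1)`, `(θ)`, and the unit `ε = 3 + θ − θ²` which is NOT a norm from `ℚ(θ, √2)`
# (KERNEL; a `--supports 22615` file; seat `bsd-2adic-k4-w1` GEN 11; layer `0` of the narrow-rank certificate of `261648q1` ONE LAYER UP)

HONEST FRAMING (cell `bsd-2adic`, D-0036/D-0054/D-0152): KERNEL theorems about ONE cubic number field; no elliptic curve, no named fact, no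
`sorry`, no definition. Closes nothing at the `∀`-level; nothing booked; BSD is not proved by any of this.

THE FIELD `E = ℚ(θ)`, `θ³ − θ² − 4θ + 2 = 0`: `disc = 316 = 4·79` is the discriminant of the polynomial, so `𝓞_E = ℤ[θ]`; `h = 1` (kernel,
`classNumber_eq_one_of_root_d316p`, GEN 5); three real roots `r₀ ≈ −1.81361`, `r₁ ≈ 0.47068`, `r₂ ≈ 2.34292` (isolated to `10⁻¹⁰`);
`2 = θ²(θ − 1)·(2θ − 1)⁻¹` with `(θ)`, `(θ − 1)` primes of norm `2` and `2θ − 1` a unit (`(2θ − 1)(−17 − 2θ + 4θ²) = 1`), so `2 = 𝔭₁𝔭₂²`,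
`𝔭₁ = (θ − 1)` UNRAMIFIED of degree one (`2 = (θ − 1)(θ² − 4)`, `θ² − 4 ≡ 1 (mod θ − 1)`), `𝔭₂ = (θ)`.  The unit `ε = 3 + θ − θ²`
(`ε(1 − θ − θ²) = 1`) satisfies `ε + 3 = (θ − 1)³(−42 − 5θ + 10θ²)`, i.e. `ε ≡ −3 (mod 𝔭₁³)`, so by the tree's dyadic lemma
(`DyadicUnitNotNormFromSqrtTwo`, GEN 10) `ε` is not of the form `x² − 2y²`: the non-norm unit that makes `h(ℚ(θ, √2))` odd (next file).

* `cubic_ids_d316` — the ring identities (any commutative ring).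
* `exists_three_ringHom_adjoin_d316`, `isTotallyReal_adjoin_d316` — three located real embeddings; `E` totally real.
* `exists_dyadic_primes_d316` — `u θ² (θ − 1) = 2`, `(θ)`, `(θ − 1)` prime, `θ − 1` a prime element with residues `{0,1}`,
  `θ − 1 ∤ u θ²`, `(θ − 1)³ ∣ ε + 3`.
* `not_exists_sq_sub_two_mul_sq_eq_eps_d316` — `ε ≠ x² − 2y²` (`x, y ∈ E`); `isUnit_eps_d316`; `odd_classNumber_adjoin_d316`.

References: [Cohen1993] §4.1.3, §4.8.2, §6.3, App. B (d = 316); [Marcus1977] Ch. 3 Thm. 22, Ch. 5 Thm. 37; [Serre1973CourseArithmetic] Ch. III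
§1.2 Thm. 1; [Omeara1963] §63B (63:10); [FrohlichTaylor1990] Ch. V §1.
-/

set_option autoImplicit false
-- sibling precedent: the directory name repeats the summit name
set_option linter.dupNamespace false

noncomputable section

open scoped Classical IntermediateField NumberField

namespace Summit.BirchSwinnertonDyer.BirchSwinnertonDyer.Theorems.AddKatoTwo

open Polynomial IsDedekindDomain NumberField Field IntermediateField
  Literature.NumberTheory.NumberFields Literature.NumberTheory.GaloisRepresentations Literature.Geometry.Kaehler.ComplexTorus

/-! ## §1 The ring identities -/

/-- **The identities of `ℤ[θ]`, `θ³ − θ² − 4θ + 2 = 0`**, in any commutative ring: `ε ε' = 1` (`ε = 3 + b − b²`, `ε' = 1 − b − b²`);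
`(b − 1)(b² − 4) = 2`; `ε + 3 = (b − 1)³(−42 − 5b + 10b²)`; `u b² (b − 1) = 2` and `u (2b − 1) = 1` (`u = −17 − 2b + 4b²`); `u b² = b² − 4`;
`(b² − 4) − 1 = (b − 1)(9 + b − 2b²)`. [folklore] [cite: Cohen1993, §4.8.2 and §6.3] -/
theorem cubic_ids_d316 {R : Type*} [CommRing R] (b : R) (hb : b ^ 3 - b ^ 2 - 4 * b + 2 = 0) :
    (3 + b - b ^ 2) * (1 - b - b ^ 2) = 1 ∧
    (b - 1) * (b ^ 2 - 4) = 2 ∧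
    (3 + b - b ^ 2) + 3 = (b - 1) ^ 3 * (-42 - 5 * b + 10 * b ^ 2) ∧
    (-17 - 2 * b + 4 * b ^ 2) * b ^ 2 * (b - 1) = 2 ∧
    (-17 - 2 * b + 4 * b ^ 2) * (2 * b - 1) = 1 ∧
    (-17 - 2 * b + 4 * b ^ 2) * b ^ 2 = b ^ 2 - 4 ∧
    (b ^ 2 - 4) - 1 = (b - 1) * (9 + b - 2 * b ^ 2) := by
  refine ⟨?_, ?_, ?_, ?_, ?_, ?_, ?_⟩
  · linear_combination ((1 : R) + (1 : R) * b) * hb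
  · linear_combination ((1 : R)) * hb
  · linear_combination ((-18 : R) + (25 : R) * b + (-10 : R) * b ^ 2) * hb
  · linear_combination ((-1 : R) + (-2 : R) * b + (4 : R) * b ^ 2) * hb
  · linear_combination ((8 : R)) * hb
  · linear_combination ((2 : R) + (4 : R) * b) * hb
  · linear_combination ((2 : R)) * hb

/-! ## §2 The three real embeddings -/

section Embeddings

variable {θ : AlgebraicClosure ℚ}

/-- The cubic relation as a real equation gives a root of `Cubic.toPoly` over `ℝ`. [folklore] -/
private theorem aeval_real_of_eq_d316 {x : ℝ} (hx : x ^ 3 + (-1) * x ^ 2 + (-4) * x + 2 = 0) :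
    aeval x (Cubic.toPoly ⟨1, ((-1 : ℤ) : ℚ), ((-4 : ℤ) : ℚ), ((2 : ℤ) : ℚ)⟩) = 0 := by
  simp only [Cubic.toPoly, map_one, one_mul, aeval_add, aeval_mul, aeval_C, aeval_X_pow, aeval_X, eq_ratCast,
    Rat.cast_intCast]
  push_cast
  linear_combination hx

/-- **The three real embeddings of `ℚ(θ)`, `θ³ − θ² − 4θ + 2 = 0`**, with located images: `ρ₀(θ) ∈ (−1.8136065027, −1.8136065026)`,
`ρ₁(θ) ∈ (0.4706834198, 0.4706834199)`, `ρ₂(θ) ∈ (2.3429230827, 2.3429230828)` (IVT + lifting). [cite: Cohen1993, §4.1.3 (real roots and signatures)] -/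
theorem exists_three_ringHom_adjoin_d316 (hθ : aeval θ (Cubic.toPoly ⟨1, ((-1 : ℤ) : ℚ), ((-4 : ℤ) : ℚ), ((2 : ℤ) : ℚ)⟩) = 0) :
    ∃ (ρ₀ ρ₁ ρ₂ : ↥ℚ⟮θ⟯ →+* ℝ) (x₀ x₁ x₂ : ℝ),
      ρ₀ (AdjoinSimple.gen ℚ θ) = x₀ ∧ ρ₁ (AdjoinSimple.gen ℚ θ) = x₁ ∧ ρ₂ (AdjoinSimple.gen ℚ θ) = x₂ ∧
      (-18136065027 / 10000000000 : ℝ) < x₀ ∧ x₀ < -18136065026 / 10000000000 ∧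
      (4706834198 / 10000000000 : ℝ) < x₁ ∧ x₁ < 4706834199 / 10000000000 ∧
      (23429230827 / 10000000000 : ℝ) < x₂ ∧ x₂ < 23429230828 / 10000000000 := by
  obtain ⟨x₀, hl₀, hu₀, hx₀⟩ := exists_cubic_root_Ioo_of_neg_of_pos (p := (-1 : ℝ)) (q := -4) (r := 2)
    (l := -18136065027 / 10000000000) (u := -18136065026 / 10000000000) (by norm_num) (by norm_num) (by norm_num)
  obtain ⟨x₁, hl₁, hu₁, hx₁⟩ := exists_cubic_root_Ioo_of_pos_of_neg (p := (-1 : ℝ)) (q := -4) (r := 2)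
    (l := 4706834198 / 10000000000) (u := 4706834199 / 10000000000) (by norm_num) (by norm_num) (by norm_num)
  obtain ⟨x₂, hl₂, hu₂, hx₂⟩ := exists_cubic_root_Ioo_of_neg_of_pos (p := (-1 : ℝ)) (q := -4) (r := 2)
    (l := 23429230827 / 10000000000) (u := 23429230828 / 10000000000) (by norm_num) (by norm_num) (by norm_num)
  obtain ⟨ρ₀, hρ₀⟩ := exists_ringHom_adjoin_apply_gen_eq (P := ⟨1, ((-1 : ℤ) : ℚ), ((-4 : ℤ) : ℚ), ((2 : ℤ) : ℚ)⟩) rfl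
    irreducible_cubic_d316p hθ (aeval_real_of_eq_d316 hx₀)
  obtain ⟨ρ₁, hρ₁⟩ := exists_ringHom_adjoin_apply_gen_eq (P := ⟨1, ((-1 : ℤ) : ℚ), ((-4 : ℤ) : ℚ), ((2 : ℤ) : ℚ)⟩) rfl
    irreducible_cubic_d316p hθ (aeval_real_of_eq_d316 hx₁)
  obtain ⟨ρ₂, hρ₂⟩ := exists_ringHom_adjoin_apply_gen_eq (P := ⟨1, ((-1 : ℤ) : ℚ), ((-4 : ℤ) : ℚ), ((2 : ℤ) : ℚ)⟩) rfl
    irreducible_cubic_d316p hθ (aeval_real_of_eq_d316 hx₂)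
  exact ⟨ρ₀, ρ₁, ρ₂, x₀, x₁, x₂, hρ₀, hρ₁, hρ₂, hl₀, hu₀, hl₁, hu₁, hl₂, hu₂⟩

/-- **`ℚ(θ)` (`d = 316`) is TOTALLY REAL** (three distinct real embeddings, degree `3`). [cite: Cohen1993, §4.1.3] -/
theorem isTotallyReal_adjoin_d316 (hθ : aeval θ (Cubic.toPoly ⟨1, ((-1 : ℤ) : ℚ), ((-4 : ℤ) : ℚ), ((2 : ℤ) : ℚ)⟩) = 0) :
    haveI : FiniteDimensional ℚ ↥ℚ⟮θ⟯ :=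
      IntermediateField.adjoin.finiteDimensional ⟨_, Cubic.monic_of_a_eq_one', by rwa [← aeval_def]⟩
    haveI : NumberField ↥ℚ⟮θ⟯ := NumberField.mk
    IsTotallyReal ↥ℚ⟮θ⟯ := by
  haveI : FiniteDimensional ℚ ↥ℚ⟮θ⟯ :=
    IntermediateField.adjoin.finiteDimensional ⟨_, Cubic.monic_of_a_eq_one', by rwa [← aeval_def]⟩
  haveI : NumberField ↥ℚ⟮θ⟯ := NumberField.mk
  have h3 : Module.finrank ℚ ↥ℚ⟮θ⟯ = 3 := finrank_adjoin_eq_three_of_irreducible irreducible_cubic_d316p hθ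
  obtain ⟨ρ₀, ρ₁, ρ₂, x₀, x₁, x₂, hρ₀, hρ₁, hρ₂, hl₀, hu₀, hl₁, hu₁, hl₂, hu₂⟩ := exists_three_ringHom_adjoin_d316 hθ
  have hne : ∀ {φ ψ : ↥ℚ⟮θ⟯ →+* ℝ} {a c : ℝ}, φ (AdjoinSimple.gen ℚ θ) = a → ψ (AdjoinSimple.gen ℚ θ) = c → a ≠ c → φ ≠ ψ := by
    intro φ ψ a c ha hc hac h; rw [h] at ha; exact hac (ha.symm.trans hc)
  have h01 : ρ₀ ≠ ρ₁ := hne hρ₀ hρ₁ (by intro h; linarith)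
  have h02 : ρ₀ ≠ ρ₂ := hne hρ₀ hρ₂ (by intro h; linarith)
  have h12 : ρ₁ ≠ ρ₂ := hne hρ₁ hρ₂ (by intro h; linarith)
  refine isTotallyReal_of_three_realEmbeddings h3 ![ρ₀, ρ₁, ρ₂] ?_
  intro a c hac
  fin_cases a <;> fin_cases c <;> simp_all

end Embeddings

/-! ## §3 The dyadic primes and the non-norm unit -/

section Field

variable (K : Type) [Field K] [NumberField K]

/-- **The dyadic structure of `E`, `θ³ − θ² − 4θ + 2 = 0`** (`[E:ℚ] = 3`, `b = θ ∈ 𝓞 E`): with `u = −17 − 2b + 4b²` a unit, `u b² (b − 1) = 2`,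
`(b)` and `(b − 1)` prime ideals (norm `2`), `b − 1` a prime ELEMENT with residue ring `{0,1}` and `(b − 1) ∤ u b²` (`𝔭₁ = (b − 1)` has
`e = f = 1`), and `(b − 1)³ ∣ ε + 3` for the unit `ε = 3 + b − b²`. [cite: Cohen1993, §4.8.2 and §6.3] [cite: Marcus1977, Ch. 3 Thm. 22] -/
theorem exists_dyadic_primes_d316 (h3 : Module.finrank ℚ K = 3) (b : 𝓞 K)
    (hb : b ^ 3 + (-1 : ℤ) * b ^ 2 + (-4 : ℤ) * b + (2 : ℤ) = 0) :
    ∃ u : 𝓞 K, IsUnit u ∧ u * b ^ 2 * (b - 1) = 2 ∧ (Ideal.span {b}).IsPrime ∧ (Ideal.span {b - 1}).IsPrime ∧ Prime (b - 1) ∧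
      (∀ t : 𝓞 K, (b - 1) ∣ t ∨ (b - 1) ∣ t - 1) ∧ ¬ (b - 1) ∣ u * b ^ 2 ∧ (b - 1) ^ 3 ∣ (3 + b - b ^ 2) + 3 := by
  have hb' : b ^ 3 - b ^ 2 - 4 * b + 2 = 0 := by push_cast at hb; linear_combination hb
  obtain ⟨-, -, heps, htwo, huinv, hub2, hw1⟩ := cubic_ids_d316 b hb'
  set u : 𝓞 K := -17 - 2 * b + 4 * b ^ 2 with hu
  have hunit : IsUnit u := IsUnit.of_mul_eq_one _ huinv
  -- norms `|N(b)| = |N(b − 1)| = 2`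
  have hirr := irreducible_cubic_d316p
  have hNb : (Algebra.norm ℤ b).natAbs = 2 := by
    have hN := natAbs_norm_coords_eq_natAbs_normPoly K h3 b (p := -1) (q := -4) (r := 2) hirr hb 0 1 0
    have he : (((0 : ℤ) : 𝓞 K) + ((1 : ℤ) : 𝓞 K) * b + ((0 : ℤ) : 𝓞 K) * b ^ 2) = b := by push_cast; ring
    rw [he] at hN; rw [hN]; norm_num
  have hNb1 : (Algebra.norm ℤ (b - 1)).natAbs = 2 := by
    have hN := natAbs_norm_coords_eq_natAbs_normPoly K h3 b (p := -1) (q := -4) (r := 2) hirr hb (-1) 1 0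
    have he : (((-1 : ℤ) : 𝓞 K) + ((1 : ℤ) : 𝓞 K) * b + ((0 : ℤ) : 𝓞 K) * b ^ 2) = b - 1 := by push_cast; ring
    rw [he] at hN; rw [hN]; norm_num
  have habs : Ideal.absNorm (Ideal.span {b}) = 2 := by rw [Ideal.absNorm_span_singleton, hNb]
  have habs1 : Ideal.absNorm (Ideal.span {b - 1}) = 2 := by rw [Ideal.absNorm_span_singleton, hNb1]
  have hP : (Ideal.span {b}).IsPrime := Ideal.isPrime_of_irreducible_absNorm (by rw [habs]; exact Nat.prime_two)
  have hP1 : (Ideal.span {b - 1}).IsPrime := Ideal.isPrime_of_irreducible_absNorm (by rw [habs1]; exact Nat.prime_two)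
  have hb10 : b - 1 ≠ 0 := by
    intro h0; rw [h0, Algebra.norm_zero] at hNb1; norm_num at hNb1
  have hprime : Prime (b - 1) := (Ideal.span_singleton_prime hb10).mp hP1
  -- residues `{0, 1}` modulo `b − 1`
  have hcard : Nat.card (𝓞 K ⧸ Ideal.span {b - 1}) = 2 := by
    rw [← Submodule.cardQuot_apply, ← Ideal.absNorm_apply, habs1]
  have hres : ∀ t : 𝓞 K, (b - 1) ∣ t ∨ (b - 1) ∣ t - 1 := by
    intro t
    by_cases ht : Ideal.Quotient.mk (Ideal.span {b - 1}) t = 0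
    · exact Or.inl (Ideal.mem_span_singleton.mp (Ideal.Quotient.eq_zero_iff_mem.mp ht))
    · right
      have h10 : (1 : 𝓞 K ⧸ Ideal.span {b - 1}) ≠ 0 := by
        haveI : Nontrivial (𝓞 K ⧸ Ideal.span {b - 1}) := Ideal.Quotient.nontrivial_iff.mpr hP1.ne_top
        exact one_ne_zero
      obtain ⟨y, -, huniq⟩ := (Nat.card_eq_two_iff' (0 : 𝓞 K ⧸ Ideal.span {b - 1})).mp hcard
      have h1 : Ideal.Quotient.mk (Ideal.span {b - 1}) t = 1 := (huniq _ ht).trans (huniq _ h10).symm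
      have h0 : Ideal.Quotient.mk (Ideal.span {b - 1}) (t - 1) = 0 := by rw [map_sub, h1, map_one, sub_self]
      exact Ideal.mem_span_singleton.mp (Ideal.Quotient.eq_zero_iff_mem.mp h0)
  -- `(b − 1) ∤ u b² = b² − 4 = 1 + (b − 1)(9 + b − 2b²)`
  have hndvd : ¬ (b - 1) ∣ u * b ^ 2 := by
    rw [hub2]
    rintro ⟨t, ht⟩
    have h1 : (b - 1) ∣ 1 := ⟨t - (9 + b - 2 * b ^ 2), by linear_combination ht - hw1⟩
    exact hprime.not_unit (isUnit_of_dvd_one h1)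
  exact ⟨u, hunit, htwo, hP, hP1, hprime, hres, hndvd, ⟨_, heps⟩⟩

/-- **The unit `ε = 3 + θ − θ²` of the cubic field of discriminant `316` is NOT of the form `x² − 2y²` (`x, y ∈ E`)** — it is not a norm
from `E(√2)`: `ε ≡ −3 (mod 𝔭₁³)` at the unramified degree-one dyadic prime `𝔭₁ = (θ − 1)` (`2 = (θ − 1)·(θ² − 4)`), and the tree's dyadic lemma
`not_exists_sq_sub_two_mul_sq_fractionRing_of_pow_three_dvd_add_three` (`(ε, 2)_{𝔭₁} = −1`). KERNEL.
[cite: Serre1973CourseArithmetic, Ch. III §1.2, Thm. 1] [cite: Omeara1963, §63B (63:10)] -/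
theorem not_exists_sq_sub_two_mul_sq_eq_eps_d316 (h3 : Module.finrank ℚ K = 3) (b : 𝓞 K)
    (hb : b ^ 3 + (-1 : ℤ) * b ^ 2 + (-4 : ℤ) * b + (2 : ℤ) = 0) :
    ¬ ∃ x y : K, x ^ 2 - 2 * y ^ 2 = (((3 + b - b ^ 2 : 𝓞 K)) : K) := by
  obtain ⟨u, -, htwo, -, -, hprime, hres, hndvd, heps⟩ := exists_dyadic_primes_d316 K h3 b hb
  have h2 : (2 : 𝓞 K) = (b - 1) * (u * b ^ 2) := by rw [← htwo]; ring
  exact not_exists_sq_sub_two_mul_sq_fractionRing_of_pow_three_dvd_add_three K hprime h2 hndvd hres heps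

omit [NumberField K] in
/-- `ε = 3 + θ − θ²` is a unit of `𝓞 E` (`ε · (1 − θ − θ²) = 1`, `N(ε) = 1`). [cite: Cohen1993, §6.3] -/
theorem isUnit_eps_d316 (b : 𝓞 K) (hb : b ^ 3 + (-1 : ℤ) * b ^ 2 + (-4 : ℤ) * b + (2 : ℤ) = 0) :
    IsUnit (3 + b - b ^ 2 : 𝓞 K) := by
  refine IsUnit.of_mul_eq_one (1 - b - b ^ 2) ?_
  push_cast at hb
  linear_combination ((1 : 𝓞 K) + (1 : 𝓞 K) * b) * hb

end Field

/-! ## §4 The class number -/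

/-- **`h(ℚ(θ))` is odd (in fact `1`) for `θ³ − θ² − 4θ + 2 = 0`** (kernel norm certificate `classNumber_eq_one_of_root_d316p`, GEN 5).
[cite: Cohen1993, App. B (totally real cubic fields: d = 316, h = 1)] [cite: Marcus1977, Ch. 5 Thm. 37] -/
theorem odd_classNumber_adjoin_d316 {θ : AlgebraicClosure ℚ}
    (hθ : aeval θ (Cubic.toPoly ⟨1, ((-1 : ℤ) : ℚ), ((-4 : ℤ) : ℚ), ((2 : ℤ) : ℚ)⟩) = 0) :
    haveI : FiniteDimensional ℚ ↥ℚ⟮θ⟯ :=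
      IntermediateField.adjoin.finiteDimensional ⟨_, Cubic.monic_of_a_eq_one', by rwa [← aeval_def]⟩
    haveI : NumberField ↥ℚ⟮θ⟯ := NumberField.mk
    Odd (classNumber ↥ℚ⟮θ⟯) := by
  haveI : FiniteDimensional ℚ ↥ℚ⟮θ⟯ :=
    IntermediateField.adjoin.finiteDimensional ⟨_, Cubic.monic_of_a_eq_one', by rwa [← aeval_def]⟩
  haveI : NumberField ↥ℚ⟮θ⟯ := NumberField.mk
  rw [NumberField.classNumber, ← Nat.card_eq_fintype_card,
    card_classGroup_adjoin_eq_one_of_forall_cubicField irreducible_cubic_d316p (classNumber_eq_one_of_root_d316p) hθ]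
  exact odd_one

end Summit.BirchSwinnertonDyer.BirchSwinnertonDyer.Theorems.AddKatoTwo

end
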